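import Literature.NumberTheory.EllipticCurves.MazurTateElementKuriharaCoefficient
import HarnessLib

/-!
# The twist lemma for Taylor coefficients of group-ring elements, and for Kurihara numbers
# (cell `b2b-bsdres`, team n1011, ROUTE 1 item R1-63 = r1 GEN 25 ROUTE-1 §37.2 (c) finding F-e; seat p06 GEN 7)

HONEST FRAMING (cell `b2b-bsdres`, run/shared/lean/b2b/bsd-rank1-residual/, verbatim in every
file): the goal of the cell is to DELETE the COMBINATION-SHAPED residual classes of the
Birch–Swinnerton-Dyer formula for ALL analytic-rank `≤ 1` elliptic curves over `ℚ` — "full BSD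
formula for every rank `≤ 1` curve in class `C`" assembled STRICTLY from published theorems — so
that the rank-`≤ 1` remainder becomes exactly the CONSTRUCTION-SHAPED classes, which are TYPED
(missing-input `Prop`s), NOT attempted. This is not "finishing BSD". Team n1011 (N10/N11; ROUTE 1,
the PORT anatomy (P-KIM) of class X4 ∧ `p = 3`): research route on CONSTRUCTION-SHAPED classes;
prove what is provable now; no claim beyond stated classes; census output = EVIDENCE, never a
Literature fact; RESIDUAL-MAP marks UNCHANGED; nothing is booked by this file. TOOL THEOREMS ONLY:
no definition, no named fact, no `sorry`; pure group-ring algebra over the tree's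
`Literature/NumberTheory/EllipticCurves/MazurTateElementKuriharaCoefficient.lean`.

## What

For a commutative ring `R`, a commutative group `G`, a ring map `φ : R → A`, additive characters
`χ_i : G → A` and a finite index set `T`, the tree's Taylor-coefficient functionals
`c_T = MazurTate.taylorCoeff φ χ T : R[G] →+ A` satisfy the product rule
`c_T(x·Θ) = ∑_{T₁ ⊆ T} c_{T₁}(x)·c_{T∖T₁}(Θ)` (`MazurTate.taylorCoeff_mul`) and `c_∅ = φ ∘ ε`
(`MazurTate.taylorCoeff_empty`, `ε` the augmentation). Hence the **twist lemma**:

* `MazurTate.taylorCoeff_mul_eq_of_forall_ssubset` — if `c_{T'}(Θ) = 0` for every PROPER subset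
  `T' ⊂ T`, then `c_T(x·Θ) = φ(ε(x))·c_T(Θ)` for EVERY `x ∈ R[G]` (only the summand `T₁ = ∅`
  survives); `MazurTate.taylorCoeff_mul_eq_zero_iff_of_forall_ssubset` — if moreover `φ(ε(x))` is
  a unit, `c_T(x·Θ) = 0 ↔ c_T(Θ) = 0`;
* the Kurihara specialisation (`R = ℤ_p`, `G = (ℤ/n)ˣ`, `φ = (ℤ_p → ℤ/p^k)`, `T` = all prime
  factors of `n`, `Θ` a `p`-integral structure of the modular element `θ̃_f(n)` as in the tree's
  `taylorCoeff_univ_eq_kuriharaNumber`):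
  `taylorCoeff_univ_mul_padicLift_eq_augmentation_mul_kuriharaNumber` — under
  `hlow : ∀ T' ⊂ univ, c_{T'}(Θ) = 0`, for ANY `x ∈ ℤ_p[(ℤ/n)ˣ]` the top Taylor coefficient of
  `x·Θ` is `(ε(x) mod p^k) · δ̃_n`, i.e. multiplying the modular element by `x` multiplies the
  Kurihara number by the augmentation of `x`; and `taylorCoeff_univ_mul_padicLift_eq_zero_iff` —
  with `ε(x)` a unit mod `p^k`, the twisted top coefficient vanishes iff `kuriharaNumber f (p^k) n ψ`
  does (a unit / non-unit certificate on `δ̃_n` transfers verbatim to the twisted element).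

Context only (NOT used, NOT claimed): the hypothesis `hlow` is, for the Mazur–Tate element at a
Kolyvagin level `n ∈ 𝒩_k`, the displayed congruence of C.-H. Kim, *Amer. J. Math.* (2026) =
arXiv:2203.12159 §3.5 (PDF p. 19), "`θ_{ℚ(μ_n)}(E) ≡ δ̃_n · ∏ (σ_{η_{ℓ_i}} − 1) mod
(I_n, (σ_{η_{ℓ_1}} − 1)², ⋯)`", which follows from the norm relations of modular elements, K. Ota,
*Amer. J. Math.* 140 (2018) Prop. 2.3 (1); it is NOT in the tree (the parent file says so) and stays
a hypothesis here (cell item R1-64, optional). The consumer is r1's finding F-e (ROUTE-1 §37.2): the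
Kolyvagin system of Kato's integral `a(A)`-type Euler system has values `ε(R_A)·δ̃_n`, so it
inhabits the PORT dictionary verbatim whenever the curve constant `ε(R_A)` is a `3`-adic unit. This
file closes nothing, books nothing, moves no mark; it adds one kernel line to a provenance argument.

Source: r1 GEN 25 scratch `cells/n1011/route1/g25_twist.lean` (sha16 c2cbac60a9838fa0, rc 0),
landed verbatim in content (namespace moved Summits-side, docstrings expanded) by the lead's deal
R5-72 (d); seat p13 GEN 7 wrote an identical re-homing (`Additive/MazurTateElementTwist.lean`,
sha16 8e4f67e836e00930, 18:22Z) under the idle rule — same four theorems, one producer by the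
lead's word. References: [Kurihara2014] arXiv:1407.2465 §1.1 (1)–(2); [Kim2022StructureSelmer] §3.5;
[Ota2018] Prop. 2.3 (1), Prop. 3.3; the parent file's module docstring.
-/

noncomputable section

open scoped BigOperators

namespace Summit.BirchSwinnertonDyer.Rank1Residual.GaloisImage

open Literature.NumberTheory.EllipticCurves Literature.NumberTheory.EllipticCurves.MazurTate

namespace MazurTate

variable {R : Type*} [CommRing R] {G : Type*} [CommGroup G] {A : Type*} [CommRing A]
  (φ : R →+* A) {ι : Type*} (χ : ι → G →* Multiplicative A)

/-- **Twist lemma** for the Taylor coefficients `c_T = MazurTate.taylorCoeff φ χ T` of a group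
ring `R[G]`: if `c_{T'}(Θ) = 0` for every proper subset `T' ⊂ T`, then
`c_T(x * Θ) = φ(ε(x)) * c_T(Θ)` for every `x ∈ R[G]` — in the product rule `taylorCoeff_mul` only
the summand `T₁ = ∅` survives, and `c_∅ = φ ∘ ε` (`taylorCoeff_empty`). [folklore] -/
theorem taylorCoeff_mul_eq_of_forall_ssubset [DecidableEq ι] (T : Finset ι)
    (x Θ : MonoidAlgebra R G) (hlow : ∀ T' ⊂ T, taylorCoeff φ χ T' Θ = 0) :
    taylorCoeff φ χ T (x * Θ) = φ (augmentation R G x) * taylorCoeff φ χ T Θ := by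
  rw [taylorCoeff_mul, Finset.sum_eq_single_of_mem ∅ (Finset.empty_mem_powerset T)]
  · rw [taylorCoeff_empty, Finset.sdiff_empty]
  · intro T₁ hT₁ hne
    rw [Finset.mem_powerset] at hT₁
    rw [hlow _ (Finset.sdiff_ssubset hT₁ (Finset.nonempty_iff_ne_empty.mpr hne)), mul_zero]

/-- **Unit twists do not change the (non-)vanishing of the top coefficient**: under the hypothesis
of `taylorCoeff_mul_eq_of_forall_ssubset`, if `φ(ε(x))` is a unit then
`c_T(x * Θ) = 0 ↔ c_T(Θ) = 0`. [folklore] -/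
theorem taylorCoeff_mul_eq_zero_iff_of_forall_ssubset [DecidableEq ι] (T : Finset ι)
    (x Θ : MonoidAlgebra R G) (hlow : ∀ T' ⊂ T, taylorCoeff φ χ T' Θ = 0)
    (hu : IsUnit (φ (augmentation R G x))) :
    taylorCoeff φ χ T (x * Θ) = 0 ↔ taylorCoeff φ χ T Θ = 0 := by
  rw [taylorCoeff_mul_eq_of_forall_ssubset φ χ T x Θ hlow]
  exact hu.mul_right_eq_zero

end MazurTate

section Kurihara

variable {N : ℕ} (f : CuspForm (CongruenceSubgroup.Gamma0 N) 2) (p : ℕ) [Fact p.Prime]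

/-- **Kurihara numbers of a twisted modular element.** For a `p`-integral structure
`Θ ∈ ℤ_p[(ℤ/n)ˣ]` of `θ̃_f(n)` (`Θ_a = [a/n]⁺_f` in `ℚ_p`, as in the tree's
`taylorCoeff_univ_eq_kuriharaNumber`) whose PROPER lower Taylor coefficients vanish in `ℤ/p^k`
(`hlow`; for `n ∈ 𝒩_k` this is Kim 2022 §3.5's displayed congruence — a hypothesis here), and ANY
`x ∈ ℤ_p[(ℤ/n)ˣ]`: the top Taylor coefficient of `x * Θ` is `(ε(x) mod p^k) · δ̃_n`,
`δ̃_n = kuriharaNumber f (p^k) n ψ`. [folklore] -/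
theorem taylorCoeff_univ_mul_padicLift_eq_augmentation_mul_kuriharaNumber (k n : ℕ) [NeZero n]
    (ψ : (ℓ : ℕ) → (ZMod ℓ)ˣ →* Multiplicative (ZMod (p ^ k)))
    {Θ : MonoidAlgebra ℤ_[p] (ZMod n)ˣ}
    (hΘ : ∀ a : (ZMod n)ˣ, ((Θ.coeff a : ℤ_[p]) : ℚ_[p]) =
      ((ratPlusSymbol f (((a : ZMod n).val : ℚ) / n) : ℚ) : ℚ_[p]))
    (hlow : ∀ T' ⊂ (Finset.univ : Finset n.primeFactors),
      taylorCoeff (PadicInt.toZModPow k)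
        (fun ℓ : n.primeFactors =>
          (ψ ℓ.1).comp (ZMod.unitsMap (Nat.dvd_of_mem_primeFactors ℓ.2))) T' Θ = 0)
    (x : MonoidAlgebra ℤ_[p] (ZMod n)ˣ) :
    taylorCoeff (PadicInt.toZModPow k)
        (fun ℓ : n.primeFactors =>
          (ψ ℓ.1).comp (ZMod.unitsMap (Nat.dvd_of_mem_primeFactors ℓ.2)))
        Finset.univ (x * Θ) =
      PadicInt.toZModPow k (augmentation ℤ_[p] (ZMod n)ˣ x) * kuriharaNumber f (p ^ k) n ψ := by
  classical
  rw [MazurTate.taylorCoeff_mul_eq_of_forall_ssubset _ _ _ x Θ hlow,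
    taylorCoeff_univ_eq_kuriharaNumber f p k n ψ hΘ]

/-- **The form an END consumer uses**: with a UNIT augmentation `ε(x) mod p^k`, the top Taylor
coefficient of the twisted element `x * Θ` vanishes iff the Kurihara number
`kuriharaNumber f (p^k) n ψ` does — a unit / non-unit certificate on `δ̃_n` transfers verbatim to
the values of the twisted system (r1 ROUTE-1 §37.2 (e)). [folklore] -/
theorem taylorCoeff_univ_mul_padicLift_eq_zero_iff (k n : ℕ) [NeZero n]
    (ψ : (ℓ : ℕ) → (ZMod ℓ)ˣ →* Multiplicative (ZMod (p ^ k)))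
    {Θ : MonoidAlgebra ℤ_[p] (ZMod n)ˣ}
    (hΘ : ∀ a : (ZMod n)ˣ, ((Θ.coeff a : ℤ_[p]) : ℚ_[p]) =
      ((ratPlusSymbol f (((a : ZMod n).val : ℚ) / n) : ℚ) : ℚ_[p]))
    (hlow : ∀ T' ⊂ (Finset.univ : Finset n.primeFactors),
      taylorCoeff (PadicInt.toZModPow k)
        (fun ℓ : n.primeFactors =>
          (ψ ℓ.1).comp (ZMod.unitsMap (Nat.dvd_of_mem_primeFactors ℓ.2))) T' Θ = 0)
    {x : MonoidAlgebra ℤ_[p] (ZMod n)ˣ}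
    (hu : IsUnit (PadicInt.toZModPow k (augmentation ℤ_[p] (ZMod n)ˣ x))) :
    taylorCoeff (PadicInt.toZModPow k)
        (fun ℓ : n.primeFactors =>
          (ψ ℓ.1).comp (ZMod.unitsMap (Nat.dvd_of_mem_primeFactors ℓ.2)))
        Finset.univ (x * Θ) = 0 ↔ kuriharaNumber f (p ^ k) n ψ = 0 := by
  rw [taylorCoeff_univ_mul_padicLift_eq_augmentation_mul_kuriharaNumber f p k n ψ hΘ hlow x]
  exact hu.mul_right_eq_zero

end Kurihara

end Summit.BirchSwinnertonDyer.Rank1Residual.GaloisImage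

end
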